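import Summits.ValiantsHypothesis.ValiantsHypothesis.Theorems.BarrierLeverDefinableEquationsUnipotentTopSupport
import Summits.ValiantsHypothesis.ValiantsHypothesis.Theorems.BarrierLeverDefinableEquationsHighestWeightVector
import Summits.ValiantsHypothesis.ValiantsHypothesis.Theorems.BarrierLeverDefinableEquationsWeightVector

/-!
# Crux `BarrierLever.DefinableEquations` (stmt-ValiantsHypothesis-8745) / `SingleSizeEquations`
# (8749) — NORMAL FORM, GCT-ready: VNP(N)-explicit HIGHEST WEIGHT VECTORS of `Sym^d(Sym^n ℂ^n)^*`

Capstone of the normal-form programme (design memo `HWV-NORMAL-FORM-PLAN.md`, evidence #9 on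
stmt-ValiantsHypothesis-8749): all three normal forms in the tree at once —

* TOP SUPPORT (`…TopEquations.lean`, lead c6; frame change `…WeightVector.lean`): only the
  coefficients `c_m`, `|m| = n`, occur;
* BOREL (`…UnipotentNormalForm/UnipotentTopSupport.lean`, this seat): invariance under every upper
  unitriangular substitution `u_t : x_j ↦ x_j + Σ_{i<j} t_ij x_i`;
* TORUS (`…Isobaric/WeightVector.lean`, g5; `…HighestWeightVector.lean`): a weight vector of
  weight `(d; w)`, `Σ_i w_i = n d`.

THEOREM (`definableEquations_iff_highestWeightVectorTop`, `singleSizeEquations_iff_highestWeightVectorTop`;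
pointwise `hwvTopEq_succ_of_eq : Eq(n, b+9, a) → HWVTopEq(n+1, b, a+7)`).  `DefinableEquations`
holds iff for ONE level `a` and EVERY `b`, eventually in `n`, there is a nonzero level-`a` Boolean
sum in the `N = C(2n,n)` coefficient variables, vanishing at `coeff f` for every
`f ∈ SmallCircuits ℂ n b`, which is a HIGHEST WEIGHT VECTOR of weight `(d; w)`, `Σ w_i = n d`, of the
`GL_n`-module `Sym^d(Sym^n ℂ^n)^*` — literally the objects of the route's layer-2 programme
(`HWVVanishesOnSlice`: "a VNP(N)-explicit HWV of weight `λ` in the ideal of the size-`n^b` forms").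
Order of extraction: top (at `n+1`), then `U`, then the torus (which normalises `U`).

HONEST FRAMING.  A normal form; it shrinks the search space for a witness and lets plethysm /
Kadish–Landsberg constraints on `(d; w)` act as constraints on witnesses.  Dominance of `w` is not
asserted (the `S_n`-sorting of `…DominantWeight.lean` does not normalise `U`).  It does NOT touch the
open content of the crux (Chatterjee–Tengse 2023 §1.3 dir. 2), 8746, 14610 or VP vs VNP.  No
definitions, no named facts.  References: [LandsbergGCT2017] §8; [KadishLandsberg2014];
[ForbesShpilkaVolk2018] Def. 1.
-/

-- layout Summits/ValiantsHypothesis/ValiantsHypothesis forces the duplicated namespace component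
set_option linter.dupNamespace false

noncomputable section

open MvPolynomial

namespace Summit.ValiantsHypothesis.ValiantsHypothesis.Theorems.BarrierLever.IsobaricEquations

open Literature.Computability.AlgebraicComplexity Literature.Barriers.ValiantsHypothesis
open Summit.ValiantsHypothesis.ValiantsHypothesis.Theorems.BarrierLever.SuccinctHittingSetsForVP
open Summit.ValiantsHypothesis.ValiantsHypothesis.Theorems.BarrierLever.BoolSumComponents
open Summit.ValiantsHypothesis.ValiantsHypothesis.Theorems.BarrierLeverDefinableEquations

/-! ## §14 The crux and the support item as highest weight vectors of `Sym^d(Sym^n ℂ^n)^*` -/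

section hwvtop

variable {n : ℕ}

/-- **Pointwise: `Eq(n, b+9, a) → HWVTopEq(n+1, b, a+7)`** (`n ≥ 2^(b+9)`, `n ≥ 63`,
`n ≥ 2a + 13`): dehomogenise to a top witness at `n + 1` (`TopEquations.topEq_succ_of_eq`,
`eq_top_of_topEq`), extract the `U`-invariant (`uEq_of_eq_top`, keeps top support), then the torus
weight vector (`isoUEq_of_uEq`, keeps support and `U`-invariance); for a top-supported weight
vector `Σ_i w_i = (n+1) d` (`weightSum_eq_of_top`). [cite: LandsbergGCT2017, §8] -/
theorem hwvTopEq_succ_of_eq {a b : ℕ} (hn : 2 ^ (b + 9) ≤ n) (h64 : 63 ≤ n) (ha : 2 * a + 13 ≤ n)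
    (h : ∃ q : ℕ, q ≤ (Nat.choose (2 * n) n) ^ a ∧
      ∃ H : MvPolynomial (↥(degLEMonomials n) ⊕ Fin q) ℂ,
        complexity H ≤ (Nat.choose (2 * n) n) ^ a ∧ H.totalDegree ≤ (Nat.choose (2 * n) n) ^ a ∧
        boolSum H ≠ 0 ∧
        ∀ f ∈ SmallCircuits ℂ n (b + 9), eval (coeffVector (degLEMonomials n) f) (boolSum H) = 0) :
    ∃ q : ℕ, q ≤ (Nat.choose (2 * (n + 1)) (n + 1)) ^ (a + 7) ∧
      ∃ H : MvPolynomial (↥(degLEMonomials (n + 1)) ⊕ Fin q) ℂ,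
        complexity H ≤ (Nat.choose (2 * (n + 1)) (n + 1)) ^ (a + 7) ∧
        H.totalDegree ≤ (Nat.choose (2 * (n + 1)) (n + 1)) ^ (a + 7) ∧ boolSum H ≠ 0 ∧
        (∀ f ∈ SmallCircuits ℂ (n + 1) b,
          eval (coeffVector (degLEMonomials (n + 1)) f) (boolSum H) = 0) ∧
        (∀ α ∈ (boolSum H).support, ∀ m ∈ α.support,
          ((m : degLEMonomials (n + 1)) : Fin (n + 1) →₀ ℕ).degree = n + 1) ∧
        (∃ (d : ℕ) (w : Fin (n + 1) → ℕ), (boolSum H).IsHomogeneous d ∧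
          (∀ i : Fin (n + 1), IsWeightedHomogeneous
            (fun m : degLEMonomials (n + 1) => (m : Fin (n + 1) →₀ ℕ) i) (boolSum H) (w i)) ∧
          ∑ i, w i = (n + 1) * d) ∧
        ∀ (t : Fin (n + 1) → Fin (n + 1) → ℂ) (f : MvPolynomial (Fin (n + 1)) ℂ), f.totalDegree ≤ n + 1 →
          eval (coeffVector (degLEMonomials (n + 1)) (aeval (unip t) f)) (boolSum H) =
            eval (coeffVector (degLEMonomials (n + 1)) f) (boolSum H) := by
  classical
  haveI : Fintype (degLEMonomials (n + 1)) := (Finsupp.finite_of_degree_le (σ := Fin (n + 1)) (n + 1)).fintype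
  have hb : 2 ^ (b + 5 + 4) ≤ n := by simpa [Nat.add_assoc] using hn
  obtain ⟨q, hq, Ht, hc, hd, hne, hvan⟩ :=
    TopEquations.topEq_succ_of_eq (a := a) (b := b + 5) (n := n) hb h
  obtain ⟨H₁, hq₁, hc₁, hd₁, hne₁, hvan₁, htop₁⟩ := eq_top_of_topEq (b := b + 5) hq Ht hc hd hne hvan
  obtain ⟨q₂, hq₂, H₂, hc₂, hd₂, hne₂, hvan₂, hinv₂, htop₂⟩ :=
    uEq_of_eq_top (a := a) (b := b + 2) (by omega) (by omega) hq₁ H₁ hc₁ hd₁ hne₁ hvan₁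
  obtain ⟨q₃, hq₃, H₃, hc₃, hd₃, hne₃, hvan₃, hsupp₃, hinv₃, d, w, hhom, hiso⟩ :=
    isoUEq_of_uEq (a := a + 4) (b := b) (by omega) (by omega) hq₂ H₂ hc₂ hd₂ hne₂ hvan₂ hinv₂
  have htop₃ : ∀ α ∈ (boolSum H₃).support, ∀ m ∈ α.support,
      ((m : degLEMonomials (n + 1)) : Fin (n + 1) →₀ ℕ).degree = n + 1 :=
    fun α hα m hm => htop₂ htop₁ α (hsupp₃ hα) m hm
  exact ⟨q₃, hq₃, H₃, hc₃, hd₃, hne₃, hvan₃, htop₃,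
    ⟨d, w, hhom, hiso, weightSum_eq_of_top hne₃ htop₃ hhom hiso⟩,
    fun t f hf => eval_coeffVector_aeval_unip_of_uAct hinv₃ t f hf⟩

/-- **`DefinableEquations` as VNP(N)-explicit highest weight vectors of `Sym^d(Sym^n ℂ^n)^*`.**
The crux holds iff for ONE level `a` and EVERY `b`, eventually in `n`, some nonzero level-`a`
Boolean-sum equation against `SmallCircuits ℂ n b` involves only the top coefficients `c_m`,
`|m| = n`, is a torus weight vector of weight `(d; w)` with `Σ_i w_i = n d`, and is invariant under
every upper unitriangular substitution — a highest weight vector of weight `(d; w)` of the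
`GL_n`-module `Sym^d(Sym^n ℂ^n)^*`. [cite: LandsbergGCT2017, §8] -/
theorem definableEquations_iff_highestWeightVectorTop :
    Summit.ValiantsHypothesis.ValiantsHypothesis.Theses.BarrierLever.DefinableEquations ↔
      ∃ a : ℕ, ∀ b : ℕ, ∃ n₀ : ℕ, ∀ n ≥ n₀, ∃ q : ℕ, q ≤ (Nat.choose (2 * n) n) ^ a ∧
        ∃ H : MvPolynomial (↥(degLEMonomials n) ⊕ Fin q) ℂ,
          complexity H ≤ (Nat.choose (2 * n) n) ^ a ∧ H.totalDegree ≤ (Nat.choose (2 * n) n) ^ a ∧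
          boolSum H ≠ 0 ∧
          (∀ f ∈ SmallCircuits ℂ n b, eval (coeffVector (degLEMonomials n) f) (boolSum H) = 0) ∧
          (∀ α ∈ (boolSum H).support, ∀ m ∈ α.support,
            ((m : degLEMonomials n) : Fin n →₀ ℕ).degree = n) ∧
          (∃ (d : ℕ) (w : Fin n → ℕ), (boolSum H).IsHomogeneous d ∧
            (∀ i : Fin n, IsWeightedHomogeneous
              (fun m : degLEMonomials n => (m : Fin n →₀ ℕ) i) (boolSum H) (w i)) ∧
            ∑ i, w i = n * d) ∧
          ∀ (t : Fin n → Fin n → ℂ) (f : MvPolynomial (Fin n) ℂ), f.totalDegree ≤ n →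
            eval (coeffVector (degLEMonomials n) (aeval (unip t) f)) (boolSum H) =
              eval (coeffVector (degLEMonomials n) f) (boolSum H) := by
  constructor
  · rintro ⟨a, h⟩
    refine ⟨a + 7, fun b => ?_⟩
    obtain ⟨n₁, hn₁⟩ := h (b + 9)
    refine ⟨max n₁ (max (2 ^ (b + 9)) (max 63 (2 * a + 13))) + 1, fun n hn => ?_⟩
    have hA := le_max_left n₁ (max (2 ^ (b + 9)) (max 63 (2 * a + 13)))
    have hB := le_max_right n₁ (max (2 ^ (b + 9)) (max 63 (2 * a + 13)))
    have hC := le_max_left (2 ^ (b + 9)) (max 63 (2 * a + 13))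
    have hD := le_max_right (2 ^ (b + 9)) (max 63 (2 * a + 13))
    have hE := le_max_left 63 (2 * a + 13)
    have hF := le_max_right 63 (2 * a + 13)
    obtain ⟨n', rfl⟩ : ∃ n', n = n' + 1 := ⟨n - 1, by omega⟩
    exact hwvTopEq_succ_of_eq (by omega) (by omega) (by omega) (hn₁ n' (by omega))
  · rintro ⟨a, h⟩
    refine ⟨a, fun b => ?_⟩
    obtain ⟨n₀, hn₀⟩ := h b
    refine ⟨n₀, fun n hn => ?_⟩
    obtain ⟨q, hq, H, hc, hd, hne, hvan, -⟩ := hn₀ n hn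
    exact ⟨q, hq, H, hc, hd, hne, hvan⟩

/-- **`SingleSizeEquations` as VNP(N)-explicit highest weight vectors of `Sym^d(Sym^n ℂ^n)^*`**
(the `∀ b ∃ a` item, stmt-ValiantsHypothesis-8749). [cite: LandsbergGCT2017, §8] -/
theorem singleSizeEquations_iff_highestWeightVectorTop :
    Summit.ValiantsHypothesis.ValiantsHypothesis.Theses.BarrierLever.SingleSizeEquations ↔
      ∀ b : ℕ, ∃ a n₀ : ℕ, ∀ n ≥ n₀, ∃ q : ℕ, q ≤ (Nat.choose (2 * n) n) ^ a ∧
        ∃ H : MvPolynomial (↥(degLEMonomials n) ⊕ Fin q) ℂ,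
          complexity H ≤ (Nat.choose (2 * n) n) ^ a ∧ H.totalDegree ≤ (Nat.choose (2 * n) n) ^ a ∧
          boolSum H ≠ 0 ∧
          (∀ f ∈ SmallCircuits ℂ n b, eval (coeffVector (degLEMonomials n) f) (boolSum H) = 0) ∧
          (∀ α ∈ (boolSum H).support, ∀ m ∈ α.support,
            ((m : degLEMonomials n) : Fin n →₀ ℕ).degree = n) ∧
          (∃ (d : ℕ) (w : Fin n → ℕ), (boolSum H).IsHomogeneous d ∧
            (∀ i : Fin n, IsWeightedHomogeneous
              (fun m : degLEMonomials n => (m : Fin n →₀ ℕ) i) (boolSum H) (w i)) ∧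
            ∑ i, w i = n * d) ∧
          ∀ (t : Fin n → Fin n → ℂ) (f : MvPolynomial (Fin n) ℂ), f.totalDegree ≤ n →
            eval (coeffVector (degLEMonomials n) (aeval (unip t) f)) (boolSum H) =
              eval (coeffVector (degLEMonomials n) f) (boolSum H) := by
  constructor
  · intro h b
    obtain ⟨a, n₁, hn₁⟩ := h (b + 9)
    refine ⟨a + 7, max n₁ (max (2 ^ (b + 9)) (max 63 (2 * a + 13))) + 1, fun n hn => ?_⟩
    have hA := le_max_left n₁ (max (2 ^ (b + 9)) (max 63 (2 * a + 13)))
    have hB := le_max_right n₁ (max (2 ^ (b + 9)) (max 63 (2 * a + 13)))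
    have hC := le_max_left (2 ^ (b + 9)) (max 63 (2 * a + 13))
    have hD := le_max_right (2 ^ (b + 9)) (max 63 (2 * a + 13))
    have hE := le_max_left 63 (2 * a + 13)
    have hF := le_max_right 63 (2 * a + 13)
    obtain ⟨n', rfl⟩ : ∃ n', n = n' + 1 := ⟨n - 1, by omega⟩
    exact hwvTopEq_succ_of_eq (by omega) (by omega) (by omega) (hn₁ n' (by omega))
  · intro h b
    obtain ⟨a, n₀, hn₀⟩ := h b
    refine ⟨a, n₀, fun n hn => ?_⟩
    obtain ⟨q, hq, H, hc, hd, hne, hvan, -⟩ := hn₀ n hn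
    exact ⟨q, hq, H, hc, hd, hne, hvan⟩

end hwvtop

end Summit.ValiantsHypothesis.ValiantsHypothesis.Theorems.BarrierLever.IsobaricEquations

end
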